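import Literature.Analysis.FunctionSpaces.BMOJohnNirenberg
import Mathlib.Analysis.SpecialFunctions.Gamma.Basic
import Mathlib.Analysis.SpecialFunctions.Pow.Integral
import HarnessLib

/-!
# `L^p` oscillation bounds for `BMO` functions from the John–Nirenberg inequality

Topic `Analysis/FunctionSpaces`; proofs file (theorems only), sibling of `BMOJohnNirenberg.lean`
(which proves the John–Nirenberg inequality `john_nirenberg_holds`). The classical corollary of
the John–Nirenberg inequality (John–Nirenberg 1961, Lemma 1' ⇒ (3); Stein, *Harmonic Analysis*,
IV.1.3, Corollary (b) of the Theorem, p. 144: "`‖f‖_{*,p} ≤ c_p ‖f‖_*`"; Grafakos, *Modern Fourier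
Analysis*, 3rd ed., Corollary 3.1.9): for every `0 < p < ∞` there is `C_p` (depending on `p`
and `dim E`) with

`∫_B ‖f − f_B‖^p ≤ C_p ‖f‖_*^p |B|` for every ball `B` and every `f ∈ BMO(E; F)`,

by the layer-cake formula `∫_B ‖h‖^p = p ∫₀^∞ t^{p-1} |{‖h‖ > t}| dt` and
`∫₀^∞ t^{p-1} c₁ e^{-c₂ t/‖f‖_*} dt = c₁ Γ(p) ‖f‖_*^p / c₂^p`; so `C_p = p c₁ Γ(p) / c₂^p`.
This is the inequality "(BMOLp)" `‖B(·,t) − B̄(t)‖_{L^p(B_R)} ≤ C_p ‖B(·,t)‖_BMO |B_R|^{1/p}`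
used with `p = 6` and `p = 2` by Lei–Zhang, J. Funct. Anal. 261 (2011) = arXiv:1011.5066, §2
p. 7 (the display labelled (BMOLp)) and §3 p. 9, in the proof of their Theorem 1.1. The case `p = 2` was already in the tree in
conditional form (`BMOInv.exists_lintegral_ball_enorm_sub_average_sq_le`,
`BMOCarlesonFeffermanStein`); here `p` is any positive real and the statement is unconditional.

## Main results

* `lintegral_Ioi_ofReal_rpow_mul_exp_neg_mul`: `∫₀^∞ t^{p-1} e^{-a t} dt = Γ(p)/a^p` in `ℝ≥0∞`.
* `exists_lintegral_ball_enorm_sub_average_rpow_le`: `∫⁻_B ‖f − f_B‖ₑ^p ≤ C_p ‖f‖_*^p |B|`.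
* `exists_eLpNorm_sub_average_le`: `‖f − f_B‖_{L^p(B)} ≤ C ‖f‖_* |B|^{1/p}` (`p : ℝ≥0`, `p ≠ 0`).

## References

* F. John, L. Nirenberg, *On functions of bounded mean oscillation*, CPAM 14 (1961), Lemma 1'
  and (3). [JohnNirenberg1961]
* E. M. Stein, *Harmonic Analysis* (1993), IV.1.3, Corollary of the Theorem. [SteinHA1993]
* L. Grafakos, *Modern Fourier Analysis*, 3rd ed. (2014), Corollary 3.1.9. [GrafakosMFA2014]
* Z. Lei, Q. S. Zhang, J. Funct. Anal. 261 (2011) 2323–2345 = arXiv:1011.5066, §2 (p. 7,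
  "(BMOLp)"). [LeiZhang2011]
-/

noncomputable section

open MeasureTheory Metric Set Filter
open scoped ENNReal NNReal Topology

namespace Literature.Analysis.FunctionSpaces

universe u v

variable {E : Type u} [NormedAddCommGroup E] [InnerProductSpace ℝ E] [FiniteDimensional ℝ E]
  [MeasurableSpace E] [BorelSpace E]
variable {F : Type v} [NormedAddCommGroup F] [NormedSpace ℝ F] [CompleteSpace F]

/-- `∫₀^∞ t^{p-1} e^{-a t} dt = Γ(p) / a^p` for `p, a > 0`, in `ℝ≥0∞` form (Mathlib's
`Real.integral_rpow_mul_exp_neg_mul_Ioi`). [folklore] -/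
theorem lintegral_Ioi_ofReal_rpow_mul_exp_neg_mul {p a : ℝ} (hp : 0 < p) (ha : 0 < a) :
    ∫⁻ t in Ioi (0 : ℝ), ENNReal.ofReal (t ^ (p - 1) * Real.exp (-(a * t))) =
      ENNReal.ofReal ((1 / a) ^ p * Real.Gamma p) := by
  have h := Real.integral_rpow_mul_exp_neg_mul_Ioi hp ha
  have hpos : 0 < (1 / a) ^ p * Real.Gamma p :=
    mul_pos (Real.rpow_pos_of_pos (by positivity) _) (Real.Gamma_pos_of_pos hp)
  have hint : IntegrableOn (fun t : ℝ => t ^ (p - 1) * Real.exp (-(a * t))) (Ioi 0) := by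
    by_contra hni
    rw [integral_undef hni] at h
    linarith
  rw [← ofReal_integral_eq_lintegral_ofReal hint, h]
  filter_upwards [ae_restrict_mem measurableSet_Ioi] with t ht
  exact mul_nonneg (Real.rpow_nonneg (le_of_lt ht) _) (Real.exp_nonneg _)

omit [NormedSpace ℝ F] [CompleteSpace F] in
/-- The enorm power as `ofReal` of the real power of the norm. [folklore] -/
theorem enorm_rpow_eq_ofReal_norm_rpow (a : F) {p : ℝ} (hp : 0 ≤ p) :
    ‖a‖ₑ ^ p = ENNReal.ofReal (‖a‖ ^ p) := by
  rw [← ofReal_norm, ENNReal.ofReal_rpow_of_nonneg (norm_nonneg _) hp]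

/-- **`L^p` oscillation bound for `BMO` (John–Nirenberg 1961, (3); Stein IV.1.3, Corollary;
Grafakos, Cor. 3.1.9).** For every `0 < p < ∞` there is `C` (depending on `p` and `dim E`) such
that every `f ∈ BMO(E; F)` satisfies `∫⁻_B ‖f − f_B‖ₑ^p ≤ C ‖f‖_*^p |B|` for all balls `B`
(layer-cake formula and the John–Nirenberg bound `|{x ∈ B : ‖f − f_B‖ > t‖f‖_*}| ≤ c₁e^{-c₂t}|B|`
of `john_nirenberg_holds`; `C = p c₁ Γ(p) / c₂^p`). [cite: SteinHA1993, IV.1.3, Corollary (b) of the Theorem] -/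
theorem exists_lintegral_ball_enorm_sub_average_rpow_le {p : ℝ} (hp : 0 < p) :
    ∃ C : ℝ≥0, ∀ (f : E → F), MemBMO f → ∀ (x : E) (r : ℝ), 0 < r →
      ∫⁻ y in ball x r, ‖f y - ⨍ z in ball x r, f z‖ₑ ^ p ≤
        C * eBMOSeminorm f ^ p * volume (ball x r) := by
  obtain ⟨c₁, c₂, hc₁, hc₂, hJ⟩ := john_nirenberg_holds E F
  set Cr : ℝ := p * c₁ * ((1 / c₂) ^ p * Real.Gamma p) with hCr
  have hCr0 : 0 ≤ Cr := by
    have : 0 < (1 / c₂) ^ p * Real.Gamma p :=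
      mul_pos (Real.rpow_pos_of_pos (by positivity) _) (Real.Gamma_pos_of_pos hp)
    positivity
  refine ⟨Cr.toNNReal, fun f hf x r hr => ?_⟩
  have hC : ((Cr.toNNReal : ℝ≥0) : ℝ≥0∞) = ENNReal.ofReal Cr := rfl
  rw [hC]
  obtain ⟨c, hc⟩ : ∃ c : F, c = ⨍ z in ball x r, f z := ⟨_, rfl⟩
  rw [← hc]
  have hBtop : volume (ball x r) ≠ ∞ := measure_ball_lt_top.ne
  have hStop : eBMOSeminorm f ≠ ∞ := hf.2.ne
  have hmeas : AEStronglyMeasurable (fun y => f y - c) (volume.restrict (ball x r)) :=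
    (hf.1.aestronglyMeasurable.sub aestronglyMeasurable_const).restrict
  -- the layer-cake representation
  have hlc : ∫⁻ y in ball x r, ‖f y - c‖ₑ ^ p =
      ENNReal.ofReal p * ∫⁻ t in Ioi 0,
        volume.restrict (ball x r) {y | t < ‖f y - c‖} * ENNReal.ofReal (t ^ (p - 1)) := by
    rw [← lintegral_rpow_eq_lintegral_meas_lt_mul (volume.restrict (ball x r))
      (Eventually.of_forall fun y => norm_nonneg _) hmeas.norm.aemeasurable hp]
    exact lintegral_congr fun y => enorm_rpow_eq_ofReal_norm_rpow _ hp.le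
  rcases eq_or_ne (eBMOSeminorm f) 0 with hS0 | hS0
  · -- `‖f‖_* = 0`: `f = c` a.e. on the ball
    have h1 : ∫⁻ y in ball x r, ‖f y - c‖ₑ = 0 := by
      have := laverage_oscillation_le_eBMOSeminorm f volume x hr
      rw [hS0, nonpos_iff_eq_zero, setLAverage_eq, ENNReal.div_eq_zero_iff] at this
      rcases this with h | h
      · rw [← hc] at h; exact h
      · exact absurd h hBtop
    have h2 : (fun y => ‖f y - c‖ₑ) =ᵐ[volume.restrict (ball x r)] 0 :=
      (lintegral_eq_zero_iff' hmeas.enorm).mp h1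
    have h3 : (fun y => ‖f y - c‖ₑ ^ p) =ᵐ[volume.restrict (ball x r)] 0 := by
      filter_upwards [h2] with y hy
      simp only [Pi.zero_apply] at hy ⊢
      rw [hy, ENNReal.zero_rpow_of_pos hp]
    rw [lintegral_congr_ae h3]
    simp
  -- main case: `0 < ‖f‖_* < ∞`
  obtain ⟨s, hs⟩ : ∃ s : ℝ, s = (eBMOSeminorm f).toReal := ⟨_, rfl⟩
  have hs0 : 0 < s := hs ▸ ENNReal.toReal_pos hS0 hStop
  have hSofReal : ENNReal.ofReal s = eBMOSeminorm f := hs ▸ ENNReal.ofReal_toReal hStop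
  -- John–Nirenberg bound on the distribution function
  have hdist : ∀ t : ℝ, 0 < t →
      volume.restrict (ball x r) {y | t < ‖f y - c‖} ≤
        ENNReal.ofReal (c₁ * Real.exp (-c₂ * (t / s))) * volume (ball x r) := by
    intro t ht
    have hJt := hJ f hf x r hr (t / s) (by positivity)
    rw [Measure.restrict_apply' measurableSet_ball]
    have hset : {y | t < ‖f y - c‖} ∩ ball x r =
        {y ∈ ball x r |
          ENNReal.ofReal (t / s) * eBMOSeminorm f < ‖f y - ⨍ z in ball x r, f z‖ₑ} := by
      ext y
      simp only [Set.mem_inter_iff, Set.mem_setOf_eq]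
      rw [← hc, ← hSofReal, ← ENNReal.ofReal_mul (by positivity), div_mul_cancel₀ t hs0.ne',
        ← ofReal_norm, ENNReal.ofReal_lt_ofReal_iff_of_nonneg ht.le, and_comm]
    rw [hset]
    exact hJt
  -- integrate the bound
  have hI : ∫⁻ t in Ioi 0,
        volume.restrict (ball x r) {y | t < ‖f y - c‖} * ENNReal.ofReal (t ^ (p - 1)) ≤
      ∫⁻ t in Ioi 0, volume (ball x r) *
        ENNReal.ofReal (c₁ * (t ^ (p - 1) * Real.exp (-((c₂ / s) * t)))) := by
    refine setLIntegral_mono' measurableSet_Ioi fun t ht => ?_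
    have ht' : (0 : ℝ) < t := ht
    calc volume.restrict (ball x r) {y | t < ‖f y - c‖} * ENNReal.ofReal (t ^ (p - 1))
        ≤ (ENNReal.ofReal (c₁ * Real.exp (-c₂ * (t / s))) * volume (ball x r)) *
            ENNReal.ofReal (t ^ (p - 1)) := by
          gcongr
          exact hdist t ht'
      _ = volume (ball x r) * ENNReal.ofReal (c₁ * (t ^ (p - 1) * Real.exp (-((c₂ / s) * t)))) := by
          rw [mul_comm (ENNReal.ofReal _) (volume _), mul_assoc,
            ← ENNReal.ofReal_mul (by positivity)]
          congr 2
          rw [show -c₂ * (t / s) = -((c₂ / s) * t) by ring]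
          ring
  have hval : ∫⁻ t in Ioi 0, volume (ball x r) *
        ENNReal.ofReal (c₁ * (t ^ (p - 1) * Real.exp (-((c₂ / s) * t)))) =
      volume (ball x r) * ENNReal.ofReal (c₁ * ((1 / (c₂ / s)) ^ p * Real.Gamma p)) := by
    rw [lintegral_const_mul' _ _ hBtop]
    congr 1
    have e1 : (fun t : ℝ => ENNReal.ofReal (c₁ * (t ^ (p - 1) * Real.exp (-((c₂ / s) * t))))) =
        fun t : ℝ => ENNReal.ofReal c₁ *
          ENNReal.ofReal (t ^ (p - 1) * Real.exp (-((c₂ / s) * t))) := by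
      funext t
      rw [ENNReal.ofReal_mul hc₁.le]
    rw [e1, lintegral_const_mul' _ _ ENNReal.ofReal_ne_top,
      lintegral_Ioi_ofReal_rpow_mul_exp_neg_mul hp (by positivity), ← ENNReal.ofReal_mul hc₁.le]
  -- assemble
  rw [hlc]
  have hreal : p * (c₁ * ((1 / (c₂ / s)) ^ p * Real.Gamma p)) = Cr * s ^ p := by
    rw [hCr, show (1 : ℝ) / (c₂ / s) = s / c₂ by field_simp, Real.div_rpow hs0.le hc₂.le,
      Real.div_rpow zero_le_one hc₂.le, Real.one_rpow]
    field_simp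
  have hfin : ENNReal.ofReal p * (volume (ball x r) *
      ENNReal.ofReal (c₁ * ((1 / (c₂ / s)) ^ p * Real.Gamma p))) =
      ENNReal.ofReal Cr * eBMOSeminorm f ^ p * volume (ball x r) := by
    rw [← hSofReal, ENNReal.ofReal_rpow_of_pos hs0, ← ENNReal.ofReal_mul hCr0,
      mul_comm (volume _) _, ← mul_assoc, ← ENNReal.ofReal_mul hp.le, hreal]
  calc ENNReal.ofReal p * ∫⁻ t in Ioi 0,
        volume.restrict (ball x r) {y | t < ‖f y - c‖} * ENNReal.ofReal (t ^ (p - 1))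
      ≤ ENNReal.ofReal p * (volume (ball x r) *
          ENNReal.ofReal (c₁ * ((1 / (c₂ / s)) ^ p * Real.Gamma p))) := by
        rw [← hval]
        gcongr
    _ = _ := hfin

/-- **`‖f − f_B‖_{L^p(B)} ≤ C ‖f‖_* |B|^{1/p}`** for `f ∈ BMO(E; F)`, `0 < p < ∞` (`p : ℝ≥0`),
all balls `B` (John–Nirenberg 1961, (3); Stein IV.1.3, Corollary: "`‖f‖_{*,p} ≤ c_p ‖f‖_*`";
the form "(BMOLp)" `‖B − B̄‖_{L^p(B_R)} ≤ C_p ‖B‖_BMO |B_R|^{1/p}` of Lei–Zhang 2011, p. 7). From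
`exists_lintegral_ball_enorm_sub_average_rpow_le` by taking `p`-th roots. [cite: SteinHA1993, IV.1.3, Corollary (b) of the Theorem] -/
theorem exists_eLpNorm_sub_average_le {p : ℝ≥0} (hp : p ≠ 0) :
    ∃ C : ℝ≥0, ∀ (f : E → F), MemBMO f → ∀ (x : E) (r : ℝ), 0 < r →
      eLpNorm (fun y => f y - ⨍ z in ball x r, f z) p (volume.restrict (ball x r)) ≤
        C * eBMOSeminorm f * volume (ball x r) ^ (1 / (p : ℝ)) := by
  have hp0 : 0 < (p : ℝ) := NNReal.coe_pos.2 (pos_iff_ne_zero.2 hp)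
  obtain ⟨C, hC⟩ := exists_lintegral_ball_enorm_sub_average_rpow_le (E := E) (F := F) hp0
  refine ⟨C ^ (1 / (p : ℝ)), fun f hf x r hr => ?_⟩
  have h := hC f hf x r hr
  rw [eLpNorm_nnreal_eq_lintegral hp]
  have hp1 : 0 ≤ 1 / (p : ℝ) := by positivity
  have h2 : (∫⁻ y in ball x r, ‖f y - ⨍ z in ball x r, f z‖ₑ ^ (p : ℝ)) ^ (1 / (p : ℝ))
      ≤ (C * eBMOSeminorm f ^ (p : ℝ) * volume (ball x r)) ^ (1 / (p : ℝ)) :=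
    ENNReal.rpow_le_rpow h hp1
  refine h2.trans_eq ?_
  rw [ENNReal.mul_rpow_of_nonneg _ _ hp1, ENNReal.mul_rpow_of_nonneg _ _ hp1]
  congr 1
  congr 1
  · exact (ENNReal.coe_rpow_of_nonneg _ hp1).symm
  · rw [← ENNReal.rpow_mul, mul_one_div_cancel hp0.ne', ENNReal.rpow_one]

end Literature.Analysis.FunctionSpaces
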